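import Literature.AlgebraicGeometry.Motives.ProjectiveOfGeneratingSections
import Literature.AlgebraicGeometry.HodgeTheory.SpreadingOutQbarFamilyProofs
import HarnessLib

/-!
# A scheme of finite type with generating sections whose non-vanishing loci are affine is quasi-projective

Topic `AlgebraicGeometry/Motives`; namespace `Literature.AlgebraicGeometry.Motives`. THEOREMS ONLY (no definition,
no named fact, no instance, no `sorry`). The quasi-projective companion of the tree's
`GeneratingSections.isProjectiveOver_of_isAffineOpen` (`Motives/ProjectiveOfGeneratingSections`): there a PROPER
`k`-scheme `Z` carrying generating-sections data `D : GeneratingSections ι Z` (an open cover `U i = Z_{sᵢ}` by the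
non-vanishing loci of finitely many generating sections `sᵢ` of an invertible sheaf, with the ratios `s_j/s_i`) whose
`U i` are AFFINE is shown to be projective; here properness is dropped and the conclusion is that `Z` is
QUASI-projective over `k` in the tree's sense (`HodgeTheory.IsQuasiProjectiveOver`: an open `k`-immersion into a
projective `k`-scheme).

In terms of line bundles this is Görtz–Wedhorn I, Prop. 13.47 ((iv) ⇒ (i): an invertible sheaf generated by finitely
many global sections `sᵢ` with `Z_{sᵢ}` affine is ample) with Thm. 13.59 / Summary 13.71 (1) (a scheme of finite
type over a field with an ample line bundle is quasi-projective: some power is very ample, i.e. induces an immersion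
into `ℙⁿ_k`), resp. Hartshorne II Thm. 7.6. The proof is the printed one in the chart form already carried out in
`ProjectiveOfGeneratingSections`: the sections `s_i^{⊗2N}` and `g̃ ⊗ s_i^{⊗N}` (`g` running through `k`-algebra
generators of the `Γ(Z, U i)`) define a morphism `Z → ℙᴹ_k` (`GeneratingSections.embData`, `toProj`) which is a
closed immersion over the charts `D₊(x_{(i, none)})` (★ `isClosedImmersion_restrict_chart_none`) whose preimages cover
`Z` (★ `iSup_preimage_chart_none`); WITHOUT properness this says exactly that `Z → ℙᴹ_k` is a (quasi-compact)
IMMERSION (`isImmersion_of_restrict`: closed immersion into the open `⋃ D₊(x_{(i,none)})`), and a `k`-scheme with a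
quasi-compact immersion into `ℙᴹ_k` is quasi-projective (★ `SpreadingOutQbar.isQuasiProjectiveOver_of_isImmersion`).

* `GeneratingSections.isImmersion_of_restrict` — a morphism which is a closed immersion over each member of a family
  of opens of the target whose preimages cover the source is an immersion;
* `GeneratingSections.isImmersion_toProj_embData` — the morphism of the embedding data is an immersion;
* **`GeneratingSections.isQuasiProjectiveOver_of_isAffineOpen`** — `Z` of finite type over `k` (locally of finite
  type; quasi-compactness follows from the finite affine cover) with data `D`, `ι` finite, all `U i` affine ⇒ `Z`
  quasi-projective over `k`;
* **`isQuasiProjectiveOver_of_isAffineHom_projectiveSpace`** — a `k`-scheme locally of finite type with an AFFINE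
  `k`-morphism to some `ℙⁿ_k` is quasi-projective (Görtz–Wedhorn I, Thm. 13.84: `r^*𝒪(1)` is ample iff `r` is
  quasi-affine; with Summary 13.71 (1)); `…_of_isFinite_projectiveSpace` (finite `r`).

Consumer (cell `hodgecm-mathlib`, count-neutral capital): the discharge of the named fact
`HodgeTheory.EGAII_isQuasiProjectiveOver_of_isFinite` (EGA II Cor. 6.1.11 with Prop. 5.3.4 (ii)) in
`HodgeTheory/QuasiProjectiveOfFinite`.

## References
* U. Görtz, T. Wedhorn, *Algebraic Geometry I: Schemes*, 2nd ed. (2020): Prop. 13.47 (pp. 392–393), Thm. 13.59 (p. 398),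
  Summary 13.71 (1) (p. 404), Thm. 13.84 (p. 408). [GortzWedhorn2020]
* R. Hartshorne, *Algebraic Geometry* (1977): II Prop. 7.2, II Thm. 7.6, II §4 Definition p. 103. [Hartshorne1977]
* A. Grothendieck, J. Dieudonné, *EGA II* (1961): Prop. 4.5.4, Thm. 4.5.2, Prop. 5.3.2. [EGAII]
-/

universe u

open CategoryTheory AlgebraicGeometry Limits TopologicalSpace Opposite
open Literature.AlgebraicGeometry.HodgeTheory (IsQuasiProjectiveOver)

noncomputable section

namespace Literature.AlgebraicGeometry.Motives

namespace GeneratingSections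

/-! ### Immersions: enough to be a closed immersion over opens of the target covering the source -/

section ImmersionCriterion

/-- A morphism `φ : T → P` which is a closed immersion over each member of a family of opens `V_a ⊆ P` whose
preimages cover `T` is an IMMERSION: `φ` factors through the open `W = ⋃ V_a` as a closed immersion (closed
immersions are Zariski-local on the target) and `W ↪ P` is an open immersion. The version with closed image —
then `φ` is a closed immersion — is ★ `isClosedImmersion_of_restrict`. [cite: GortzWedhorn2020, Thm. 13.59 (p. 398), proof] -/
theorem isImmersion_of_restrict {T P : Scheme.{u}} (φ : T ⟶ P) {κ : Type*}
    (Vs : κ → P.Opens) (hcov : ⨆ a, φ ⁻¹ᵁ Vs a = ⊤)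
    (hV : ∀ a, IsClosedImmersion (φ ∣_ Vs a)) :
    ∃ (W : P.Opens) (φ' : T ⟶ (W : Scheme.{u})), IsClosedImmersion φ' ∧ φ' ≫ W.ι = φ := by
  set W : P.Opens := ⨆ a, Vs a with hW
  have hrange : Set.range φ ⊆ Set.range W.ι := by
    rw [Scheme.Opens.range_ι]
    rintro _ ⟨x, rfl⟩
    have hx : x ∈ (⊤ : T.Opens) := trivial
    rw [← hcov, Opens.mem_iSup] at hx
    obtain ⟨a, ha⟩ := hx
    exact Opens.mem_iSup.mpr ⟨a, ha⟩
  set φ' := IsOpenImmersion.lift W.ι φ hrange with hφ'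
  have hfac : φ' ≫ W.ι = φ := IsOpenImmersion.lift_fac _ _ _
  have hφ'cl : IsClosedImmersion φ' := by
    refine IsZariskiLocalAtTarget.of_iSup_eq_top (fun a ↦ W.ι ⁻¹ᵁ Vs a) ?_ fun a ↦ ?_
    · rw [← Scheme.Hom.preimage_iSup, ← hW, Scheme.Opens.ι_preimage_self]
    · have h : IsClosedImmersion ((φ' ≫ W.ι) ∣_ Vs a) := by
        rw [hfac]
        exact hV a
      rw [morphismRestrict_comp] at h
      have h' : IsClosedImmersion (φ' ∣_ (W.ι ⁻¹ᵁ Vs a) ≫ W.ι ∣_ Vs a) := h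
      exact IsClosedImmersion.of_comp (φ' ∣_ (W.ι ⁻¹ᵁ Vs a)) (W.ι ∣_ Vs a)
  exact ⟨W, φ', hφ'cl, hfac⟩

/-- Under the hypotheses of `isImmersion_of_restrict`, `φ` is an immersion. [cite: GortzWedhorn2020, Thm. 13.59 (p. 398), proof] -/
theorem isImmersion_of_restrict' {T P : Scheme.{u}} (φ : T ⟶ P) {κ : Type*}
    (Vs : κ → P.Opens) (hcov : ⨆ a, φ ⁻¹ᵁ Vs a = ⊤)
    (hV : ∀ a, IsClosedImmersion (φ ∣_ Vs a)) : IsImmersion φ := by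
  obtain ⟨W, φ', hφ', hfac⟩ := isImmersion_of_restrict φ Vs hcov hV
  rw [← hfac]
  infer_instance

/-- Under the hypotheses of `isImmersion_of_restrict`, `φ` is quasi-compact as soon as `P` is locally Noetherian
(a closed immersion followed by an open immersion into a locally Noetherian scheme).
[cite: GortzWedhorn2020, Thm. 13.59 (p. 398), proof] -/
theorem quasiCompact_of_restrict {T P : Scheme.{u}} (φ : T ⟶ P) {κ : Type*} [IsLocallyNoetherian P]
    (Vs : κ → P.Opens) (hcov : ⨆ a, φ ⁻¹ᵁ Vs a = ⊤)
    (hV : ∀ a, IsClosedImmersion (φ ∣_ Vs a)) : QuasiCompact φ := by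
  obtain ⟨W, φ', hφ', hfac⟩ := isImmersion_of_restrict φ Vs hcov hV
  rw [← hfac]
  infer_instance

end ImmersionCriterion

/-! ### The immersion defined by generating sections with affine non-vanishing loci -/

section QuasiProjective

variable {ι : Type} {k : Type u} [Field k] {Z : SchemeOver k} [Finite ι] (D : GeneratingSections ι Z.left)
  (hU : ∀ i, IsAffineOpen (D.U i))

omit [Finite ι] hU in
include D in
/-- A scheme with generating-sections data indexed by an empty type is empty. [folklore] -/
private theorem isEmpty_of_isEmpty_index [IsEmpty ι] : IsEmpty Z.left :=
  ⟨fun z ↦ by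
    have hz : z ∈ (⊤ : Z.left.Opens) := trivial
    rw [← D.iSup_U, Opens.mem_iSup] at hz
    obtain ⟨i, -⟩ := hz
    exact IsEmpty.elim inferInstance i⟩

omit D hU [Finite ι] in
/-- The empty `k`-scheme is quasi-projective. [folklore] -/
private theorem isQuasiProjectiveOver_of_isEmpty [IsEmpty Z.left] : IsQuasiProjectiveOver Z :=
  IsQuasiProjectiveOver.of_isProjectiveOver isProjectiveOver_of_isEmpty

omit D hU [Finite ι] in
/-- `ℙⁿ_k` is locally Noetherian. [folklore] -/
private theorem isLocallyNoetherian_projectiveSpace (n : ℕ) : IsLocallyNoetherian (projectiveSpace n k).left := by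
  haveI : LocallyOfFiniteType (projectiveSpace n k).hom :=
    haveI : IsProper (projectiveSpace n k).hom := isProper_projectiveSpace n k
    inferInstance
  exact LocallyOfFiniteType.isLocallyNoetherian (projectiveSpace n k).hom

omit D hU [Finite ι] in
/-- `ℙⁿ_k` is projective over `k` (the identity is a closed `k`-immersion). [folklore] -/
private theorem isProjectiveOver_projectiveSpace' (n : ℕ) : IsProjectiveOver (projectiveSpace n k) :=
  ⟨n, 𝟙 _, by rw [Over.id_left]; infer_instance⟩

include hU in
/-- **A `k`-scheme locally of finite type carrying generating-sections data with finitely many, affine, non-vanishing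
loci `U i = Z_{sᵢ}` is quasi-projective over `k`.** In terms of the invertible sheaf `𝓛` glued from the data: `𝓛` is
generated by finitely many global sections `sᵢ` with `Z_{sᵢ}` affine, hence ample (Görtz–Wedhorn I, Prop. 13.47
(iv) ⇒ (i)), and a scheme of finite type over a field with an ample line bundle is quasi-projective (Görtz–Wedhorn I,
Thm. 13.59 with Summary 13.71 (1); Hartshorne II Thm. 7.6). Proof in chart form: the morphism `Z → ℙᴹ_k` of the
embedding data ★ `embData` (sections `s_i^{⊗2N}`, `g̃ ⊗ s_i^{⊗N}`) is a closed immersion over the charts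
`D₊(x_{(i,none)})` (★ `isClosedImmersion_restrict_chart_none`), which pull back to a cover of `Z`
(★ `iSup_preimage_chart_none`); so it is a quasi-compact immersion into `ℙᴹ_k`, and ★
`SpreadingOutQbar.isQuasiProjectiveOver_of_isImmersion` concludes.
[cite: GortzWedhorn2020, Prop. 13.47 (pp. 392–393) and Thm. 13.59 (p. 398) with Summary 13.71 (1) (p. 404)]
[cite: Hartshorne1977, II Thm. 7.6] -/
theorem isQuasiProjectiveOver_of_isAffineOpen [LocallyOfFiniteType Z.hom] : IsQuasiProjectiveOver Z := by
  classical
  cases isEmpty_or_nonempty ι with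
  | inl hι =>
    haveI : IsEmpty Z.left := D.isEmpty_of_isEmpty_index
    exact isQuasiProjectiveOver_of_isEmpty
  | inr hι =>
    haveI := Fintype.ofFinite ι
    obtain ⟨i₀⟩ := hι
    -- reindex the embedding data by `Fin (n + 1)`
    have hcard : Fintype.card (D.Index Z.hom hU) =
        (Fintype.card (D.Index Z.hom hU) - 1) + 1 :=
      (Nat.sub_add_cancel (Fintype.card_pos_iff.mpr ⟨⟨i₀, none⟩⟩)).symm
    set n := Fintype.card (D.Index Z.hom hU) - 1 with hn
    set e : Fin (n + 1) ≃ D.Index Z.hom hU := (Fintype.equivFinOfCardEq hcard).symm with he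
    -- the morphism `Z → ℙⁿ_k` of the reindexed embedding data is a closed immersion over the charts
    -- `D₊(x_a)`, `e a = (i, none)`, whose preimages cover `Z`
    let φ : Z ⟶ projectiveSpace n k := ((D.embData Z.hom hU).reindex e).toProjectiveSpace
    have hφ : φ.left = ((D.embData Z.hom hU).reindex e).toProj Z.hom := toProjectiveSpace_left _
    have hcov := D.iSup_preimage_chart_none Z.hom hU e
    have hV := fun a : {a : Fin (n + 1) // ∃ i, e a = ⟨i, none⟩} ↦
      D.isClosedImmersion_restrict_chart_none Z.hom hU e a.1 a.2
    haveI : IsImmersion φ.left := by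
      rw [hφ]
      exact isImmersion_of_restrict' _ _ hcov hV
    haveI : IsLocallyNoetherian (projectiveSpace n k).left := isLocallyNoetherian_projectiveSpace n
    haveI : QuasiCompact φ.left := by
      rw [hφ]
      exact quasiCompact_of_restrict _ _ hcov hV
    exact HodgeTheory.SpreadingOutQbar.isQuasiProjectiveOver_of_isImmersion φ
      (isProjectiveOver_projectiveSpace' n)

end QuasiProjective

end GeneratingSections

/-! ### Schemes affine or finite over `ℙⁿ_k` are quasi-projective -/

section AffineOverProjectiveSpace

variable {n : ℕ} {k : Type u} [Field k] {Z : SchemeOver k} [LocallyOfFiniteType Z.hom]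
  (r : Z ⟶ projectiveSpace n k)

/-- **A `k`-scheme locally of finite type with an affine `k`-morphism to `ℙⁿ_k` is quasi-projective** (Görtz–Wedhorn
I, Thm. 13.84: for `r : X → ℙⁿ` over `S = Spec k`, `r^*𝒪(1)` is ample iff `r` is quasi-affine, in particular if `r` is
affine; with Summary 13.71 (1): finite type with an ample line bundle ⇒ quasi-projective). Here: the generating
sections `r^* xᵢ` have the affine non-vanishing loci `r⁻¹ D₊(xᵢ)` (★ `GeneratingSections.ofHom`), so
`GeneratingSections.isQuasiProjectiveOver_of_isAffineOpen` applies.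
[cite: GortzWedhorn2020, Thm. 13.84 (p. 408) with Summary 13.71 (1) (p. 404)] -/
theorem isQuasiProjectiveOver_of_isAffineHom_projectiveSpace [h : IsAffineHom r.left] : IsQuasiProjectiveOver Z :=
  (GeneratingSections.ofHom (k := k) (ι := Fin (n + 1)) r.left).isQuasiProjectiveOver_of_isAffineOpen
    (fun i ↦ @GeneratingSections.isAffineOpen_ofHom_U (Fin (n + 1)) k _ Z.left r.left h i)

/-- A `k`-scheme locally of finite type and finite over `ℙⁿ_k` is quasi-projective (indeed projective when proper:
★ `isProjectiveOver_of_isFinite`). [cite: GortzWedhorn2020, Thm. 13.84 (p. 408) with Summary 13.71 (1) (p. 404)] -/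
theorem isQuasiProjectiveOver_of_isFinite_projectiveSpace [IsFinite r.left] : IsQuasiProjectiveOver Z :=
  isQuasiProjectiveOver_of_isAffineHom_projectiveSpace r

end AffineOverProjectiveSpace

end Literature.AlgebraicGeometry.Motives

end
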